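import Summits.RiemannHypothesis.RiemannHypothesis.Theses.WeilComb
import Summits.RiemannHypothesis.RiemannHypothesis.Theorems.WeilCombCombShapeDetection
import Summits.RiemannHypothesis.RiemannHypothesis.Theorems.WeilCombCombShapeAdmissible
import Summits.RiemannHypothesis.RiemannHypothesis.Theorems.WeilCombCombShapePositivityStubDilationGeometry
import Summits.RiemannHypothesis.RiemannHypothesis.Theorems.WeilCombCombShapePositivityFejerOfCrux
import Summits.RiemannHypothesis.RiemannHypothesis.Theorems.FejerDivisorPositivity
import Literature.NumberTheory.LFunctions.WeilCriterionConverse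
import Literature.NumberTheory.LFunctions.WeilExplicitFormulaProofs
import Literature.NumberTheory.LFunctions.WeilExplicitProofs
import Literature.NumberTheory.LFunctions.WeilMellinBounds
import Literature.NumberTheory.LFunctions.WeilMellinInversion
import Literature.NumberTheory.LFunctions.WeilDilationVirial
import Literature.NumberTheory.LFunctions.WeilZeroSum
import Literature.NumberTheory.LFunctions.LandauOscillation
import Mathlib

/-!
# Dilation detection V — the jump across the least-angle cut: `stub_dilationDetection`

stub-plan `Cruxes/CombShapePositivity/STUB-PLAN-stub_fejer.md`, tier ★T2 DILATION DETECTION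
(crux `WeilComb.CombShapePositivity`, item stmt-RiemannHypothesis-11229, route route-RiemannHypothesis-WeilComb,
line `Sketch`; sprove seat). The five files `…StubDilationSeries` → `…KernelSum` → `…Landau` → `…Geometry` →
`…Detection` prove `stub_dilationDetection : (∀ ε ≥ 1, 0 ≤ Re W(φ_ε ⋆ φ̃_ε)) → RiemannHypothesis`
(a theorem ABOUT the RH-equivalent stub `stub_fejer` — its `S = ∅` face is already RH-complete — not a step
of `CombShapePositivity_of`).

This file: the approach points `w₀t₀ ± η·i w₀/|w₀|` enter the two sectors for small `η > 0`, and the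
registered stub `stub_dilationDetection`: assuming an off-line zero, `F` (holomorphic on `Re s > 0` by
Landau) equals `G_univ = G_L + G_{Lᶜ}` on both sectors, `F` and `G_{Lᶜ}` are continuous at `w₀t₀`, so the
jump of the finite sum `G_L` vanishes — but it equals `−(2πi/w₀) Σ_{ρ∈L} (m(ρ)/|c_ρ|) ψ₀(t₀/|c_ρ|) ≠ 0`.
Hence RH; corollaries: the minimal face `RH ⟺ ∀ ε > 0, 0 ≤ Re W(φ_ε ⋆ φ̃_ε)` and fixed tori.
-/

noncomputable section

-- the sub-problem path RiemannHypothesis/RiemannHypothesis duplicates a namespace (D-0017)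
set_option linter.dupNamespace false

open scoped BigOperators ComplexConjugate Real Topology
open Complex MeasureTheory Set Filter

namespace Summit.RiemannHypothesis.RiemannHypothesis.Theorems.WeilCombBohrFejer

open Literature.NumberTheory.LFunctions
open Literature.NumberTheory.LFunctions.WeilConverse

/-! ## Notation (local, purely syntactic abbreviations of sub-terms of the registered stubs) -/

/-- the route bump `φ_ε(t) = ε⁻¹ φ₀(t/ε)` (verbatim sub-term of the registered stubs). -/
local notation "φb(" ε ")" =>
  (fun t : ℝ => ((ε : ℝ) : ℂ)⁻¹ * ((expNegInvGlue (1 - (t / ε) ^ 2) : ℝ) : ℂ))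

/-- the fixed bump as a complex function `φ₀ℂ(u) = expNegInvGlue (1 - u²)`. -/
local notation "φ₀ℂ" => (fun u : ℝ => ((expNegInvGlue (1 - u ^ 2) : ℝ) : ℂ))

/-- its entire transform `Φ₀(z) = ∫ φ₀(u) e^{zu} du`. -/
local notation "Φ₀(" z ")" =>
  (∫ u : ℝ, ((expNegInvGlue (1 - u ^ 2) : ℝ) : ℂ) * Complex.exp (z * u))

/-- the autocorrelation `ψ₀ = φ₀ ⋆ φ₀`. -/
local notation "ψ₀(" t ")" =>
  (∫ u : ℝ, expNegInvGlue (1 - u ^ 2) * expNegInvGlue (1 - (t - u) ^ 2))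

/-- the Cauchy–Laplace kernel of `ψ₀`: `K(w, s) = ∫_{-2}^{2} ψ₀(t) e^{wt − s}/(s − wt) dt`. -/
local notation "Kψ(" w ", " s ")" =>
  (∫ t in (-2 : ℝ)..2, (((∫ u : ℝ, expNegInvGlue (1 - u ^ 2) * expNegInvGlue (1 - (t - u) ^ 2)) : ℝ) : ℂ) *
    Complex.exp (w * t - s) / (s - w * t))

/-- the set of non-trivial zeros (subtype). -/
local notation "𝒵" => ZetaZeros.riemannZetaNontrivialZeros

/-- `g(x) = Re Q(φ_{log x})` for `x > e`, `0` otherwise — the non-negative function of Landau's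
lemma, in the multiplicative variable `x = e^ε`. Written with `max 1 (log x)` so that measurability
is immediate. -/
local notation "gL" =>
  (Set.indicator (Set.Ioi (Real.exp 1)) (fun x : ℝ => Complex.re (weilQuadratic φb(max 1 (Real.log x)))))

/-- the kernel attached to a complex number `ρ'` (weighted by the multiplicity) restricted to a
set `P` of zeros. -/
local notation "KP(" P ", " ρ' ", " s ")" =>
  (Set.indicator P (fun ρ'' : ℂ => (riemannZetaZeroOrder ρ'' : ℂ) * Kψ(ρ'' - 1 / 2, s)) ρ')

/-- the zero sum of kernels over the zeros in `P`: `G_P(s) = Σ_{ρ ∈ P} m(ρ) K(ρ − ½, s)`. -/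
local notation "GK(" P ", " s ")" => (∑' ρ : 𝒵, KP(P, (ρ : ℂ), s))

set_option quotPrecheck false in
/-- the natural domain of `G_P`: the right half-plane minus the segments `(ρ − ½)·[−2, 2]` of the
zeros `ρ ∈ P` (segments of on-line zeros lie on the imaginary axis and are excluded for free). -/
local notation "UP(" P ")" =>
  (setOf fun s : ℂ => 0 < Complex.re s ∧ ∀ ρ' : ℂ, ρ' ∈ P → ρ' ∈ ZetaZeros.riemannZetaNontrivialZeros →
    ∀ t : ℝ, t ∈ Set.Icc (-2 : ℝ) 2 → s ≠ (ρ' - 1 / 2) * t)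

/-- The upper approach points lie in the upper sector for small `η > 0`. [folklore] -/
theorem eventually_mem_secP {w₀ : ℂ} (ha : 0 < w₀.re) (hg : 0 < w₀.im) {t₀ : ℝ} (ht₀ : 0 < t₀)
    {r₁ : ℝ} (hr₁ : w₀.im / w₀.re < r₁) :
    ∀ᶠ η : ℝ in 𝓝[>] 0, (w₀ * t₀ + η * (I * w₀ / (‖w₀‖ : ℂ))) ∈
      {s : ℂ | 0 < s.re ∧ (w₀.im / w₀.re) * s.re < s.im ∧ s.im < r₁ * s.re} := by
  set N : ℝ := ‖w₀‖ with hN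
  have hN0 : 0 < N := norm_pos_iff.2 (fun h => by rw [h] at ha; simp at ha)
  set a : ℝ := w₀.re
  set γ : ℝ := w₀.im
  have hc1 : Continuous fun η : ℝ => a * t₀ - η * (γ / N) := by fun_prop
  have hc3 : Continuous fun η : ℝ => (γ * t₀ + η * (a / N)) - r₁ * (a * t₀ - η * (γ / N)) := by
    fun_prop
  have hv1 : (0 : ℝ) < a * t₀ - 0 * (γ / N) := by simpa using mul_pos ha ht₀
  have hv3 : (γ * t₀ + 0 * (a / N)) - r₁ * (a * t₀ - 0 * (γ / N)) < 0 := by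
    have : γ < r₁ * a := (div_lt_iff₀ ha).1 hr₁
    simp; nlinarith
  have e1 : ∀ᶠ η : ℝ in 𝓝[>] 0, 0 < a * t₀ - η * (γ / N) :=
    ((hc1.tendsto 0).mono_left nhdsWithin_le_nhds).eventually_const_lt hv1
  have e3 : ∀ᶠ η : ℝ in 𝓝[>] 0, (γ * t₀ + η * (a / N)) - r₁ * (a * t₀ - η * (γ / N)) < 0 :=
    ((hc3.tendsto 0).mono_left nhdsWithin_le_nhds).eventually_lt_const hv3
  have e2 : ∀ᶠ η : ℝ in 𝓝[>] 0, (0 : ℝ) < η := eventually_mem_nhdsWithin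
  filter_upwards [e1, e2, e3] with η h1 h2 h3
  obtain ⟨hre, him, -, -⟩ := approach_re_im w₀ t₀ η
  refine ⟨by rw [hre]; exact h1, ?_, ?_⟩
  · rw [hre, him]
    have e : γ / a * (a * t₀ - η * (γ / N)) = γ * t₀ - η * (γ / a * (γ / N)) := by
      field_simp
    rw [e]
    have : 0 < η * (γ / a * (γ / N)) := by positivity
    have : 0 < η * (a / N) := by positivity
    linarith
  · rw [hre, him]; linarith

/-- The lower approach points lie in the lower sector for small `η > 0`. [folklore] -/
theorem eventually_mem_secM {w₀ : ℂ} (ha : 0 < w₀.re) (hg : 0 < w₀.im) {t₀ : ℝ} (ht₀ : 0 < t₀) :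
    ∀ᶠ η : ℝ in 𝓝[>] 0, (w₀ * t₀ - η * (I * w₀ / (‖w₀‖ : ℂ))) ∈
      {s : ℂ | 0 < s.re ∧ |s.im| < (w₀.im / w₀.re) * s.re} := by
  set N : ℝ := ‖w₀‖ with hN
  have hN0 : 0 < N := norm_pos_iff.2 (fun h => by rw [h] at ha; simp at ha)
  set a : ℝ := w₀.re
  set γ : ℝ := w₀.im
  have hc : Continuous fun η : ℝ => η * (a / N) - η * (γ / a * (γ / N)) - 2 * (γ * t₀) := by
    fun_prop
  have hv : (0 : ℝ) * (a / N) - 0 * (γ / a * (γ / N)) - 2 * (γ * t₀) < 0 := by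
    simp; positivity
  have e1 : ∀ᶠ η : ℝ in 𝓝[>] 0, η * (a / N) - η * (γ / a * (γ / N)) - 2 * (γ * t₀) < 0 :=
    ((hc.tendsto 0).mono_left nhdsWithin_le_nhds).eventually_lt_const hv
  have e2 : ∀ᶠ η : ℝ in 𝓝[>] 0, (0 : ℝ) < η := eventually_mem_nhdsWithin
  filter_upwards [e1, e2] with η h1 h2
  obtain ⟨-, -, hre, him⟩ := approach_re_im w₀ t₀ η
  have hre0 : 0 < a * t₀ + η * (γ / N) := by positivity
  refine ⟨by rw [hre]; exact hre0, ?_⟩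
  rw [hre, him, abs_lt]
  have e : γ / a * (a * t₀ + η * (γ / N)) = γ * t₀ + η * (γ / a * (γ / N)) := by
    field_simp
  rw [e]
  have : 0 < η * (γ / a * (γ / N)) := by positivity
  have : 0 < η * (a / N) := by positivity
  constructor <;> linarith

/-! ## B3 · the theorem -/

/-- **T2 `stub_dilationDetection` — DILATION DETECTION.** If `Re W(φ_ε ⋆ φ̃_ε) ≥ 0` for every width
`ε ≥ 1`, then the Riemann hypothesis holds. Proof: Landau's lemma in the dilation variable makes the
Laplace transform `F` of the (non-negative) diagonal holomorphic on `Re s > 0`; it coincides with the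
zero sum of kernels `G` on the two sectors adjacent to the least-angle off-line line; across that line
`G` has the non-zero jump `−(2πi/w₀) Σ (m/|c|) ψ₀(t₀/|c|)` while `F` and the other-zeros part are
continuous — contradiction. [folklore] -/
theorem stub_dilationDetection :
    (∀ ε : ℝ, 1 ≤ ε → 0 ≤ (weilQuadratic
      (fun t : ℝ => (ε : ℂ)⁻¹ * ((expNegInvGlue (1 - (t / ε) ^ 2) : ℝ) : ℂ))).re) →
    RiemannHypothesis := by
  intro hpos
  refine riemannHypothesis_iff_strip_holds.2 fun ρ hζ h0 h1 => ?_
  by_contra hoff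
  have hρ : ρ ∈ 𝒵 := ZetaZeros.riemannZetaNontrivialZeros.mem_iff'.2 ⟨hζ, h0, h1⟩
  -- the least-angle off-line zero `ρ₀` and the gap `(r₀, r₁)`
  obtain ⟨ρ₀, hρ₀, ha₀, hg₀, hmin, r₁, hr₁, hgap⟩ := exists_least_ratio hρ hoff
  set w₀ : ℂ := ρ₀ - 1 / 2 with hw₀def
  set r₀ : ℝ := ρ₀.im / (ρ₀.re - 1 / 2) with hr₀def
  have hw₀re : w₀.re = ρ₀.re - 1 / 2 := by simp [hw₀def]
  have hw₀im : w₀.im = ρ₀.im := by simp [hw₀def]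
  have ha₀' : 0 < w₀.re := by rw [hw₀re]; linarith
  have hg₀' : 0 < w₀.im := by rw [hw₀im]; exact hg₀
  have hw₀ : w₀ ≠ 0 := fun h => by rw [h] at ha₀'; simp at ha₀'
  have hr₀pos : 0 < r₀ := div_pos hg₀ (by linarith)
  have hr₀w : w₀.im / w₀.re = r₀ := by rw [hw₀re, hw₀im]
  -- the sectors and the Landau cone are segment-free
  set SM : Set ℂ := {s : ℂ | 0 < s.re ∧ |s.im| < r₀ * s.re} with hSM
  set SP : Set ℂ := {s : ℂ | 0 < s.re ∧ r₀ * s.re < s.im ∧ s.im < r₁ * s.re} with hSP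
  have hSM_U : SM ⊆ UP(Set.univ) := by
    rintro s ⟨hre, him⟩
    refine ⟨hre, fun ρ' _ hρ' t _ heq => ?_⟩
    have := (seg_geometry hr₀pos hmin hgap hρ' heq hre).1
    linarith
  have hSP_U : SP ⊆ UP(Set.univ) := by
    rintro s ⟨hre, h1, h2⟩
    exact ⟨hre, fun ρ' _ hρ' t _ heq => (seg_geometry hr₀pos hmin hgap hρ' heq hre).2 ⟨h1, h2⟩⟩
  have hW : ∀ s : ℂ, 0 < s.re → |s.im| < r₀ / 2 * s.re → s ∈ UP(Set.univ) := by
    intro s hre him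
    refine hSM_U ⟨hre, ?_⟩
    have : 0 < r₀ / 2 * s.re := by positivity
    linarith
  -- Landau: `F` is holomorphic on `Re s > 0` and equals `G` on the two sectors
  have hF := differentiableOn_mellinIoi_gL hpos (half_pos hr₀pos) hW
  have hEqM : EqOn (Landau.mellinIoi gL) (fun s : ℂ => GK(Set.univ, s)) SM :=
    eqOn_mellinIoi_GK hF (isOpen_secM r₀) (convex_secM r₀) hSM_U (p := (3 : ℂ))
      ⟨by simp, by simp; positivity⟩ (by norm_num)
  have hEqP : EqOn (Landau.mellinIoi gL) (fun s : ℂ => GK(Set.univ, s)) SP := by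
    refine eqOn_mellinIoi_GK hF (isOpen_secP r₀ r₁) (convex_secP r₀ r₁) hSP_U
      (p := (3 : ℂ) + (3 * ((r₀ + r₁) / 2) : ℝ) * I) ⟨by simp, ?_, ?_⟩ (by norm_num)
    · simp; nlinarith
    · simp; nlinarith
  -- the zeros on the least-angle line
  set PL : Set ℂ := {ρ' : ℂ | ∃ c : ℝ, ρ' - 1 / 2 = (c : ℂ) * w₀} with hPL
  have hLfin : {ρ' : 𝒵 | (ρ' : ℂ) ∈ PL}.Finite := finite_line_zeros ha₀ hg₀
  set LF : Finset 𝒵 := hLfin.toFinset with hLF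
  have hmemLF : ∀ ρ' : 𝒵, ρ' ∈ LF ↔ (ρ' : ℂ) ∈ PL := fun ρ' => by
    rw [hLF, Set.Finite.mem_toFinset]; rfl
  have hρ₀L : (⟨ρ₀, hρ₀⟩ : 𝒵) ∈ LF := (hmemLF _).2 ⟨1, by simp [hw₀def]⟩
  have hLFne : LF.Nonempty := ⟨_, hρ₀L⟩
  -- the scalars `|c|` and the base point `t₀`
  set μ : 𝒵 → ℝ := fun ρ' => ‖((ρ' : ℂ) - 1 / 2) / w₀‖ with hμ
  have hμc : ∀ ρ' : 𝒵, ∀ c : ℝ, (ρ' : ℂ) - 1 / 2 = (c : ℂ) * w₀ → μ ρ' = |c| := by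
    intro ρ' c hc
    simp only [hμ, hc, mul_div_assoc, div_self hw₀, mul_one, Complex.norm_real, Real.norm_eq_abs]
  have hμpos : ∀ ρ' : 𝒵, 0 < μ ρ' := by
    intro ρ'
    simp only [hμ, norm_pos_iff]
    refine div_ne_zero (fun h => ?_) hw₀
    have := ZetaZeros.riemannZetaNontrivialZeros.im_ne_zero ρ'.2
    have h' := congrArg Complex.im h
    simp at h'
    exact this h'
  set t₀ : ℝ := min 1 (LF.inf' hLFne μ) with ht₀def
  have ht₀pos : 0 < t₀ := by
    refine lt_min one_pos ?_
    obtain ⟨ρ', hρ', h⟩ := LF.exists_mem_eq_inf' hLFne μ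
    rw [h]; exact hμpos ρ'
  have ht₀le : ∀ ρ' ∈ LF, t₀ ≤ μ ρ' := fun ρ' hρ' =>
    (min_le_right _ _).trans (Finset.inf'_le μ hρ')
  have ht₀1 : t₀ ≤ 1 := min_le_left _ _
  -- the base point is off the segments of the other zeros
  set sb : ℂ := w₀ * (t₀ : ℂ) with hsb
  have hsbre : 0 < sb.re := by
    have : sb.re = w₀.re * t₀ := by simp [hsb, Complex.mul_re]
    rw [this]; exact mul_pos ha₀' ht₀pos
  have hsbR : sb ∈ UP(PLᶜ) := by
    refine ⟨hsbre, fun ρ' hρ'P _ t _ heq => hρ'P ?_⟩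
    have ht : (t : ℂ) ≠ 0 := by
      intro ht0
      rw [ht0, mul_zero] at heq
      rw [heq] at hsbre
      simp at hsbre
    refine ⟨t₀ / t, ?_⟩
    have e : ρ' - 1 / 2 = sb / (t : ℂ) := by rw [heq]; field_simp
    rw [e, hsb]
    push_cast
    field_simp
  have hRcont : ContinuousAt (fun s : ℂ => GK(PLᶜ, s)) sb := (differentiableAt_GK _ hsbR).continuousAt
  have hFcont : ContinuousAt (Landau.mellinIoi gL) sb :=
    (hF.differentiableAt ((isOpen_lt continuous_const Complex.continuous_re).mem_nhds hsbre)).continuousAt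
  -- approach points
  set n : ℂ := I * w₀ / (‖w₀‖ : ℂ) with hn
  have hsP : Tendsto (fun η : ℝ => sb + η * n) (𝓝[>] 0) (𝓝 sb) := by
    have h : Continuous fun η : ℝ => sb + η * n := by fun_prop
    have := (h.tendsto 0).mono_left (nhdsWithin_le_nhds (s := Set.Ioi 0))
    simpa using this
  have hsM : Tendsto (fun η : ℝ => sb - η * n) (𝓝[>] 0) (𝓝 sb) := by
    have h : Continuous fun η : ℝ => sb - η * n := by fun_prop
    have := (h.tendsto 0).mono_left (nhdsWithin_le_nhds (s := Set.Ioi 0))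
    simpa using this
  have hevP : ∀ᶠ η : ℝ in 𝓝[>] 0, sb + η * n ∈ SP := by
    have h := eventually_mem_secP ha₀' hg₀' ht₀pos (r₁ := r₁) (by rw [hr₀w]; exact hr₁)
    rw [hr₀w] at h
    exact h
  have hevM : ∀ᶠ η : ℝ in 𝓝[>] 0, sb - η * n ∈ SM := by
    have h := eventually_mem_secM ha₀' hg₀' ht₀pos
    rw [hr₀w] at h
    exact h
  -- the jump of `G_L` along the normal is `0` …
  set D : ℝ → ℂ := fun η => GK(PL, sb + η * n) - GK(PL, sb - η * n) with hD
  have hD0 : Tendsto D (𝓝[>] 0) (𝓝 0) := by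
    have hlim : Tendsto (fun η : ℝ => (Landau.mellinIoi gL (sb + η * n) - GK(PLᶜ, sb + η * n)) -
        (Landau.mellinIoi gL (sb - η * n) - GK(PLᶜ, sb - η * n))) (𝓝[>] 0) (𝓝 0) := by
      have h1 := (hFcont.tendsto.comp hsP).sub (hRcont.tendsto.comp hsP)
      have h2 := (hFcont.tendsto.comp hsM).sub (hRcont.tendsto.comp hsM)
      have := h1.sub h2
      simpa using this
    refine hlim.congr' ?_
    filter_upwards [hevP, hevM] with η hP hM
    have hPU := hSP_U hP
    have hMU := hSM_U hM
    have e1 : Landau.mellinIoi gL (sb + η * n) = GK(Set.univ, sb + η * n) := hEqP hP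
    have e2 : Landau.mellinIoi gL (sb - η * n) = GK(Set.univ, sb - η * n) := hEqM hM
    simp only [hD]
    rw [e1, e2, GK_univ_eq_add PL hPU, GK_univ_eq_add PL hMU]
    ring
  -- … and it is the finite sum of the single-kernel jumps, which is non-zero
  have hGL : ∀ s : ℂ, GK(PL, s) = ∑ ρ' ∈ LF, (riemannZetaZeroOrder (ρ' : ℂ) : ℂ) * Kψ((ρ' : ℂ) - 1 / 2, s) := by
    intro s
    rw [GK_eq_sum PL LF (fun ρ' h => (hmemLF ρ').2 h)]
    refine Finset.sum_congr rfl fun ρ' hρ' => ?_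
    rw [Set.indicator_of_mem ((hmemLF ρ').1 hρ')]
  set J : 𝒵 → ℂ := fun ρ' => (riemannZetaZeroOrder (ρ' : ℂ) : ℂ) *
    (-(2 * π * I / (((μ ρ' : ℝ) : ℂ) * w₀)) * (((ψ₀(t₀ / μ ρ')) : ℝ) : ℂ)) with hJ
  have hDlim : Tendsto D (𝓝[>] 0) (𝓝 (∑ ρ' ∈ LF, J ρ')) := by
    have h2 : Tendsto (fun η : ℝ => ∑ ρ' ∈ LF, (riemannZetaZeroOrder (ρ' : ℂ) : ℂ) *
        (Kψ((ρ' : ℂ) - 1 / 2, sb + η * n) - Kψ((ρ' : ℂ) - 1 / 2, sb - η * n)))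
        (𝓝[>] 0) (𝓝 (∑ ρ' ∈ LF, J ρ')) := by
      refine tendsto_finsetSum _ fun ρ' hρ' => ?_
      obtain ⟨c, hc⟩ := (hmemLF ρ').1 hρ'
      have hc0 : c ≠ 0 := by
        rintro rfl
        have := ZetaZeros.riemannZetaNontrivialZeros.im_ne_zero ρ'.2
        have h' := congrArg Complex.im hc
        simp at h'
        exact this h'
      have hμ' : μ ρ' = |c| := hμc ρ' c hc
      simp only [hJ, hμ']
      refine Tendsto.const_mul _ ?_
      have hj := kernel_jump_on_line hw₀ hc0 ht₀pos (by rw [← hμ']; exact ht₀le ρ' hρ')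
      simp only [hsb, hn]
      rw [hc]
      exact hj
    refine h2.congr fun η => ?_
    simp only [hD, hGL]
    rw [← Finset.sum_sub_distrib]
    exact Finset.sum_congr rfl fun _ _ => by ring
  have hJsum : ∑ ρ' ∈ LF, J ρ' = -(2 * π * I / w₀) *
      ((∑ ρ' ∈ LF, (riemannZetaZeroOrder (ρ' : ℂ) : ℝ) / μ ρ' * ψ₀(t₀ / μ ρ') : ℝ) : ℂ) := by
    rw [Complex.ofReal_sum, Finset.mul_sum]
    refine Finset.sum_congr rfl fun ρ' _ => ?_
    have hμ0 : ((μ ρ' : ℝ) : ℂ) ≠ 0 := Complex.ofReal_ne_zero.2 (hμpos ρ').ne'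
    simp only [hJ]
    push_cast
    field_simp
  have hSpos : 0 < ∑ ρ' ∈ LF, (riemannZetaZeroOrder (ρ' : ℂ) : ℝ) / μ ρ' * ψ₀(t₀ / μ ρ') := by
    refine Finset.sum_pos' (fun ρ' _ => ?_) ⟨⟨ρ₀, hρ₀⟩, hρ₀L, ?_⟩
    · have hm : (0 : ℝ) ≤ riemannZetaZeroOrder (ρ' : ℂ) := by
        exact_mod_cast riemannZetaZeroOrder_nonneg (ZetaZeros.riemannZetaNontrivialZeros.ne_one ρ'.2)
      exact mul_nonneg (div_nonneg hm (hμpos ρ').le) (bumpAutocorr_nonneg _)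
    · have hm : (1 : ℝ) ≤ riemannZetaZeroOrder ρ₀ := by
        exact_mod_cast ZetaZeros.riemannZetaNontrivialZeros.one_le_order hρ₀
      have hμ1 : μ ⟨ρ₀, hρ₀⟩ = 1 := by
        have := hμc ⟨ρ₀, hρ₀⟩ 1 (by simp [hw₀def])
        simpa using this
      rw [hμ1, div_one, div_one]
      refine mul_pos (by linarith) (bumpAutocorr_pos t₀ ⟨by linarith, by linarith⟩)
  have hJne : ∑ ρ' ∈ LF, J ρ' ≠ 0 := by
    rw [hJsum]
    refine mul_ne_zero ?_ (Complex.ofReal_ne_zero.2 hSpos.ne')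
    refine neg_ne_zero.2 (div_ne_zero (mul_ne_zero (mul_ne_zero two_ne_zero ?_) Complex.I_ne_zero) hw₀)
    exact Complex.ofReal_ne_zero.2 Real.pi_ne_zero
  exact hJne (tendsto_nhds_unique hDlim hD0)

/-! ## Corollaries: the minimal face -/

/-- **The minimal face.** `RiemannHypothesis ⟺ ∀ ε > 0, 0 ≤ Re W(φ_ε ⋆ φ̃_ε)`: Weil positivity on the
dilation orbit of ONE autocorrelated bump is already RH-complete (`⇒`: the `S = ∅` face of
`fejer_of_riemannHypothesis`; `⇐`: `stub_dilationDetection`). Consequently the registered stub `stub_fejer`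
(≡ `FejerDivisorPositivity` ≡ RH) is equivalent to its `S = ∅` face and the crux `CombShapePositivity` to its
`M = 1` cells; any cell family unbounded in `ε` is RH-complete. [folklore] -/
theorem riemannHypothesis_iff_weilQuadratic_bump_nonneg :
    RiemannHypothesis ↔ ∀ ε : ℝ, 0 < ε → 0 ≤ (weilQuadratic φb(ε)).re := by
  constructor
  · intro hRH ε hε
    have h := fejer_of_riemannHypothesis hRH ε hε ∅ (by simp) 0 (fun _ => 0)
    have e : weilQuadratic φb(ε) =
        weilFunctional (weilTranslate (weilConv φb(ε) (weilReflect φb(ε))) 0) := by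
      unfold weilQuadratic; congr 1; funext t; simp [weilTranslate]
    rw [e]
    simpa using h
  · exact fun h => stub_dilationDetection fun ε hε => h ε (by linarith)

/-- **RH ⟺ the Fejér faces on any fixed prime torus** (e.g. `T²_{2,3}`): for a fixed finite set of primes
`S`, `RiemannHypothesis ⟺ ∀ ε > 0, ∀ n θ, 0 ≤ Re Σ_{d,d' ∣ ∏_{p∈S}p^n} χ_θ(d) conj χ_θ(d') W(τ_{log d − log d'} ψ_ε)`
(the `n = 0` face of every `S` is the diagonal). [folklore] -/
theorem riemannHypothesis_iff_fejer_fixed_torus (S : Finset ℕ) (hS : ∀ p ∈ S, p.Prime) :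
    RiemannHypothesis ↔ ∀ ε : ℝ, 0 < ε → ∀ (n : ℕ) (θ : ℕ → ℝ),
      0 ≤ (∑ d ∈ (∏ p ∈ S, p ^ n).divisors, ∑ d' ∈ (∏ p ∈ S, p ^ n).divisors,
        Complex.exp (I * ((∑ p ∈ S, θ p * (d.factorization p : ℝ) : ℝ) : ℂ)) *
          conj (Complex.exp (I * ((∑ p ∈ S, θ p * (d'.factorization p : ℝ) : ℝ) : ℂ))) *
          weilFunctional (weilTranslate (weilConv φb(ε) (weilReflect φb(ε)))
            (Real.log (d : ℝ) - Real.log (d' : ℝ)))).re := by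
  constructor
  · intro hRH ε hε n θ
    exact fejer_of_riemannHypothesis hRH ε hε S hS n θ
  · intro h
    refine riemannHypothesis_iff_weilQuadratic_bump_nonneg.2 fun ε hε => ?_
    have h0 := h ε hε 0 (fun _ => 0)
    have e : weilQuadratic φb(ε) =
        weilFunctional (weilTranslate (weilConv φb(ε) (weilReflect φb(ε))) 0) := by
      unfold weilQuadratic; congr 1; funext t; simp [weilTranslate]
    rw [e]
    simpa using h0

/-- **`FejerDivisorPositivity` ⟺ its `S = ∅` face.** The named RH-equivalent crux is already decided by the
single-bump diagonal `ε ↦ Re W(φ_ε ⋆ φ̃_ε)`. [folklore] -/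
theorem fejerDivisorPositivity_iff_weilQuadratic_bump_nonneg :
    FejerDivisorPositivity ↔ ∀ ε : ℝ, 0 < ε → 0 ≤ (weilQuadratic φb(ε)).re :=
  fejerDivisorPositivity_iff_riemannHypothesis.trans riemannHypothesis_iff_weilQuadratic_bump_nonneg

end Summit.RiemannHypothesis.RiemannHypothesis.Theorems.WeilCombBohrFejer

end
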